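import Mathlib
import Summits.ValiantsHypothesis.ValiantsHypothesis.Theorems.FifoMatchingNNLowDegreeCofactorHardCofactorBuysVertices
import Literature.Computability.AlgebraicComplexity.NestFreeMatchingPoly
import HarnessLib

/-!
# Route FifoMatching — crux `NNLinearDegreeCofactorHard` (stmt-ValiantsHypothesis-23918), line `internal_cofactor`:
# stub S1 `stub_topInternalComponent` (the top vertex-potential component is an INTERNAL cofactor)

Registered line `Cruxes/NNLinearDegreeCofactorHard/Lines/internal_cofactor.lean` (three registered stubs; the
composition `NNLinearDegreeCofactorHard_of_line` is kernel-checked there). This file proves stub **S1**, VERBATIM: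

* `stub_topInternalComponent` — for every nonzero `h ∈ ℝ≥0[x_(i,j)]` on `[2n]` there are a vertex set
  `R ⊆ [2n]` with `|R| ≤ 2·deg h` and a nonzero `p` with `deg p ≤ deg h`, every arc of every monomial of `p`
  having BOTH endpoints in `R`, and `L₊(NN_n · p) ≤ L₊(NN_n · h)`.

Proof (citation-level, as the line card prescribes): `p := top_w h`, the top component for the
vertex-potential weight `w = vertexWeight (2·deg h + 1)`; the landed `exists_vertices_topComponent`
(`Theorems/FifoMatchingNNLowDegreeCofactorHardCofactorBuysVertices.lean`) gives `R` with `|R| ≤ 2·deg h` carrying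
every arc of every monomial of `top_w h`; `top_w h ≠ 0` (`topComponent_ne_zero`), `supp (top_w h) ⊆ supp h`
(`support_topComponent_subset`) bounds the degree, and since `NN_n` is `w`-homogeneous
(`isWeightedHomogeneous_nestFreeMatchingPoly`) one has `top_w (NN_n · h) = NN_n · top_w h` (`topComponent_mul`,
`topComponent_eq_self_of_isWeightedHomogeneous`), so the free-initial-form bound `complexity_topComponent_le`
gives `L₊(NN_n · top_w h) ≤ L₊(NN_n · h)`.

Honest framing: S1 is bookkeeping; the line's content is S2b (`stub_denseInternalHard`, OPEN) and the landed
engine S2a; the crux `NNLinearDegreeCofactorHard`, `NNDivisionHard`, `NNNotVP` stay OPEN; monotone ≠ general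
(`Literature.Barriers.ValiantsHypothesis.MonotoneGap`); nothing here is progress on `VP ≠ VNP` (NOT proved).
No definitions, no named facts.
-/

noncomputable section

-- Sub = Summit single-conjunct layout: the duplicated namespace component is mandated by the tree.
set_option linter.dupNamespace false

namespace Summit.ValiantsHypothesis.ValiantsHypothesis.Theorems.FifoMatching.NNLinearDegreeCofactorHard.InternalCofactor

open MvPolynomial Finset Literature.Computability.AlgebraicComplexity
open Summit.ValiantsHypothesis.ValiantsHypothesis.Theorems.ZeroOneTransfer.Negative
open Summit.ValiantsHypothesis.ValiantsHypothesis.Theorems.FifoMatching.NNLowDegreeCofactorHard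
open scoped NNReal

/-- The top component of `h` has total degree at most that of `h` (its support is a sub-support).
[folklore] -/
theorem totalDegree_topComponent_le {σ : Type*} (w : σ → ℕ) (h : MvPolynomial σ ℝ≥0) :
    (topComponent w h).totalDegree ≤ h.totalDegree :=
  Finset.sup_mono (support_topComponent_subset w h)

/-- Multiplying by the `w`-homogeneous `NN_n` commutes with taking the top `w`-component, so the free
initial-form bound applies: `L₊(NN_n · top_w h) ≤ L₊(NN_n · h)`. [folklore] -/
theorem complexity_mul_topComponent_le (n B : ℕ) (h : MvPolynomial (Fin (2 * n) × Fin (2 * n)) ℝ≥0) :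
    complexity (nestFreeMatchingPoly n ℝ≥0 * topComponent (vertexWeight B) h) ≤
      complexity (nestFreeMatchingPoly n ℝ≥0 * h) := by
  have := complexity_topComponent_le (vertexWeight B) (nestFreeMatchingPoly n ℝ≥0 * h)
  rwa [topComponent_mul, topComponent_eq_self_of_isWeightedHomogeneous (vertexWeight B)
    (isWeightedHomogeneous_nestFreeMatchingPoly n _)] at this

/-- **STUB S1 of the line `internal_cofactor` (`stub_topInternalComponent`), verbatim.** For every nonzero
cofactor `h ∈ ℝ≥0[x_(i,j)]` there are `R ⊆ [2n]` with `|R| ≤ 2·deg h` and a nonzero INTERNAL cofactor `p` on `R`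
(all arcs of all monomials inside `R × R`) with `deg p ≤ deg h` and `L₊(NN_n · p) ≤ L₊(NN_n · h)` — namely the top
vertex-potential component of `h`. Crux `NNLinearDegreeCofactorHard` (stmt-ValiantsHypothesis-23918) stays OPEN on
S2b. [folklore] -/
theorem stub_topInternalComponent :
    ∀ (n : ℕ) (h : MvPolynomial (Fin (2 * n) × Fin (2 * n)) ℝ≥0), h ≠ 0 →
      ∃ R : Finset (Fin (2 * n)), R.card ≤ 2 * h.totalDegree ∧
        ∃ p : MvPolynomial (Fin (2 * n) × Fin (2 * n)) ℝ≥0, p ≠ 0 ∧ p.totalDegree ≤ h.totalDegree ∧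
          (∀ d ∈ p.support, ∀ e ∈ d.support, e.1 ∈ R ∧ e.2 ∈ R) ∧
          complexity (nestFreeMatchingPoly n ℝ≥0 * p) ≤ complexity (nestFreeMatchingPoly n ℝ≥0 * h) := by
  intro n h hh
  obtain ⟨R, hR, hint⟩ := exists_vertices_topComponent hh
  exact ⟨R, hR, topComponent (vertexWeight (2 * h.totalDegree + 1)) h, topComponent_ne_zero _ hh,
    totalDegree_topComponent_le _ h, hint, complexity_mul_topComponent_le n _ h⟩

end Summit.ValiantsHypothesis.ValiantsHypothesis.Theorems.FifoMatching.NNLinearDegreeCofactorHard.InternalCofactor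

end
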